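import Literature.Computability.AlgebraicComplexity.BDI20GridLikeLayeredGraphs
import Literature.Computability.AlgebraicComplexity.BDI20ColouringGadgets
import HarnessLib

/-!
# Bläser–Dörfler–Ikenmeyer 2020, §8 (CCC 2021 Lemma 8.7): a CROSSBAR layout of an arbitrary graph as
# a subgraph of a grid with equality / inequality edges, built from the crossing gadget `H_4'`

M. Bläser, J. Dörfler, C. Ikenmeyer, *On the complexity of evaluating highest weight vectors*,
arXiv:2002.11594 (= CCC 2021, LIPIcs 200:29), §8, Lemma 28 [8.7] and its crossing gadget `H_4'`
(Fig. `fig:3colgridcrossing`; TeX of record `HOME/lit/src/2002.11594/fullversion.tex` L2083–2120,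
L2229–2271). Cell `val-lit`, seat x6 g8 (closer-owner of the §8 programme, lead-np RULING (124));
file C′ of `HOME/np/NOTE-x6g8-BDI20-sec8-LAYOUT.md`. HONEST FRAMING: layout plumbing for an NP- /
ETH-hardness proof about EVALUATING highest weight vectors; nothing here bears on `VP ≠ VNP`, which
is NOT proved. No conjecture, no named fact, no `instance`, no notation; `0` sorries.

## What the print does and what this file does instead (disclosed deviation)

Lemma 28 reduces 3SAT to RELATIONAL 3-colouring of a subgraph of an `O(m) × O(m)` grid (edges are
"equality" or "inequality" edges) by a border gadget `H_1'`, variable gadgets `H_2'`, clause gadgets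
`H_3'` and the crossing gadget `H_4'`, routing literal occurrences to their clauses "via an iterative
procedure" of adjacent swaps ("After at most `O(m)` of these steps the vertices are sorted") — a
layout given in prose, with the sorting bound not proved in print. Lemma 29 then replaces every
relational edge by the gadgets of Lemma 26 to get an `8`-regular grid-like layered graph, and Thm 30
builds the tableau. For the formal proof of Thm 30 [8.9] we feed Lemma 29 with a DIFFERENT family of
relational grid subgraphs, obtained from an ARBITRARY graph (so that the NP clause reduces from
`THREECOL`, as the tree's proof of Thm 8.1 does, and the ETH clause from the `O(m)`-vertex graph of a
3-CNF, x6 g7's `BDI20BoundedDegreeSatGraph`), with the same two printed ingredients — a grid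
subgraph with relational edges, and `H_4'` — and NO sorting: the **crossbar**.

* Input: `V` vertices, adjacency `adj : ℕ → ℕ → Bool` (only `adj i j` for `i ≠ j < V` matters).
* Output `Crossbar.crossbar V adj : RelGridGraph (45 V²)` (FILE A's structure, t20): a `V × V` array
  of `8 × 8` cells; cell `(i, j)` (corner `(8j, 8i)`) carries ROW WIRE `i` (entering from the left at
  `(0,6)`, leaving to the right at `(7,6)`) and COLUMN WIRE `j` (entering from the top at `(2,0)`,
  leaving at the bottom at `(2,7)`), which cross through a copy of `H_4'` on `[2,6]²` (ports
  `a = (2,2)` column in, `a' = (6,6)` column out, `b' = (2,6)` row in, `b = (6,2)` row out; FILE B's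
  data `crossingGadget.eqEdges/neEdges`, `crossingGadget_forces`, `crossingColouring`,
  `crossingGadget_extends`), joined to the ports by equality paths; a STUB of equality edges runs
  from the row entry `(0,6)` down the left column to `(1,1)`, next to the column entry `(2,1)`, and
  the edge `(1,1)–(2,1)` is an EQUALITY edge in the diagonal cells `i = j` (so row wire `i` and
  column wire `i` carry one colour: together they are vertex `i`), an INEQUALITY edge when `adj i j`
  (`i ≠ j`), and absent otherwise. Consecutive cells are linked by the equality edges
  `(2,7)_{(i,j)} – (2,0)_{(i+1,j)}` and `(7,6)_{(i,j)} – (0,6)_{(i,j+1)}`. `45` lattice points per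
  cell, all inside the cell's half-open box, so positions are injective by `div`/`mod`
  (`posN_injective`); every edge is a unit grid edge (`local_grid`, kernel check); every vertex lies
  on an edge (`exists_adj` — Lemma 29's regularisation needs no isolated vertex); the whole graph
  sits in the `8V × 8V` grid (`pos_lt`), i.e. `|V'| = 45 V² = O(V²)` — for the ETH source `V = O(m)`
  this is the printed `|V(G)| = O(m²)`.
* ★ `Crossbar.isRelColourable_crossbar_iff :
  (crossbar V adj).IsRelColourable ↔ ∃ col : ℕ → Fin 3, IsProperFor V adj col` — relational
  3-colourings of the crossbar correspond to proper 3-colourings of the input graph. (→): wires are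
  monochromatic (`cell_wires`: equality paths and `H_4'`'s `a = a'`, `b = b'`; `row_const`,
  `col_const`), row and column wire of a vertex agree (`row_eq_col`, the join edge), and the
  relation edge of cell `(i, j)` separates adjacent vertices. (←): `crossbarColouring` colours cell
  `(i, j)` by `cellColouring (col j) (col i)` (FILE B's `crossingColouring` on `H_4'`, the wire
  colours elsewhere; `cellColouring_local` is a kernel check of the nine port pairs).

## References
* [BlaserDorflerIkenmeyer2020] arXiv:2002.11594 Lemma 28 and Fig. 3colgridcrossing (= CCC 2021
  Lemma 8.7); Lemma 29 (= 8.8) for what consumes this file.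
* [GareyJohnsonStockmeyer1976] the planar crossing gadget embedded as `H_4'`.
* Tree: `BDI2020.RelGridGraph`, `GridAdjacent`, `IsProperRel`, `IsRelColourable`
  (`BDI20GridLikeLayeredGraphs.lean`, t20 g10); `BDI2020.Gadgets.crossingGadget.*`,
  `crossingGadget_forces`, `crossingColouring` (`BDI20ColouringGadgets.lean`, t20 g10).
-/

namespace Literature.Computability.AlgebraicComplexity

namespace BDI2020

namespace Crossbar

open Gadgets

/-! ### The cell: `45` lattice points of an `8 × 8` box -/

/-- The local positions of the `45` points of a cell (box `[0,8)²`, `x` to the right, `y` downwards):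
`0..24` = the crossing gadget `H_4'` translated to `[2,6]²` (FILE B numbering `t ↦ (t % 5, t / 5)`,
so `a = 0 ↦ (2,2)`, `b = 4 ↦ (6,2)`, `b' = 20 ↦ (2,6)`, `a' = 24 ↦ (6,6)`); `25, 26` = the column
wire entering from the top `(2,0), (2,1)`; `27..31` = the column wire leaving `a'` along the bottom
row `(6,7) … (2,7)`; `32, 33` = the row wire entering from the left `(0,6), (1,6)`; `34..38` = the
row wire leaving `b` down the right column `(7,2) … (7,6)`; `39..44` = the stub `(0,5) … (0,1), (1,1)`
from the row entry to the point next to the column entry.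
[cite: BlaserDorflerIkenmeyer2020, Lemma 28, proof and Fig. 3colgridcrossing (arXiv; = CCC 2021 Lemma 8.7)] -/
def offTable : List (ℕ × ℕ) :=
  [(2,2), (3,2), (4,2), (5,2), (6,2), (2,3), (3,3), (4,3), (5,3), (6,3), (2,4), (3,4), (4,4), (5,4),
    (6,4), (2,5), (3,5), (4,5), (5,5), (6,5), (2,6), (3,6), (4,6), (5,6), (6,6),
    (2,0), (2,1), (6,7), (5,7), (4,7), (3,7), (2,7), (0,6), (1,6), (7,2), (7,3), (7,4), (7,5), (7,6),
    (0,5), (0,4), (0,3), (0,2), (0,1), (1,1)]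

/-- Local position of local point `s` (default `(0,0)` beyond `44`, never used). [cite: BlaserDorflerIkenmeyer2020, Lemma 28, proof (arXiv; = CCC 2021 Lemma 8.7)] -/
def off (s : ℕ) : ℕ × ℕ := offTable.getD s (0, 0)

/-- The EQUALITY edges inside a cell: the twelve equality edges of `H_4'` and the wire / stub paths
`25-26-a`, `a'-27-28-29-30-31`, `32-33-b'`, `b-34-35-36-37-38`, `32-39-40-41-42-43-44`.
[cite: BlaserDorflerIkenmeyer2020, Lemma 28, proof ("connected by a path of equality edges") and Fig. 3colgridcrossing (arXiv; = CCC 2021 Lemma 8.7)] -/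
def localEq : List (ℕ × ℕ) :=
  (crossingGadget.eqEdges.map fun e => (e.1.val, e.2.val)) ++
    [(25,26), (26,0), (24,27), (27,28), (28,29), (29,30), (30,31), (32,33), (33,20), (4,34), (34,35),
      (35,36), (36,37), (37,38), (32,39), (39,40), (40,41), (41,42), (42,43), (43,44)]

/-- The INEQUALITY edges inside a cell: the twenty-four inequality edges of `H_4'`.
[cite: BlaserDorflerIkenmeyer2020, Lemma 28, Fig. 3colgridcrossing (arXiv; = CCC 2021 Lemma 8.7)] -/
def localNe : List (ℕ × ℕ) := crossingGadget.neEdges.map fun e => (e.1.val, e.2.val)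

/-! ### Indexing: vertex `45·(V·i + j) + s` = local point `s` of cell `(i, j)` -/

/-- Number of vertices of the crossbar on `V` input vertices. [cite: BlaserDorflerIkenmeyer2020, Lemma 28 ("G is a subgraph of an O(m) × O(m) grid, so |V(G)| = O(m²)") (arXiv; = CCC 2021 Lemma 8.7)] -/
def nV (V : ℕ) : ℕ := 45 * (V * V)

/-- The row (input vertex of the row wire) of a crossbar vertex. [cite: BlaserDorflerIkenmeyer2020, Lemma 28, proof (arXiv; = CCC 2021 Lemma 8.7)] -/
def rowOf (V v : ℕ) : ℕ := v / 45 / V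

/-- The column (input vertex of the column wire) of a crossbar vertex. [cite: BlaserDorflerIkenmeyer2020, Lemma 28, proof (arXiv; = CCC 2021 Lemma 8.7)] -/
def colOf (V v : ℕ) : ℕ := v / 45 % V

/-- The local point of a crossbar vertex. [cite: BlaserDorflerIkenmeyer2020, Lemma 28, proof (arXiv; = CCC 2021 Lemma 8.7)] -/
def locOf (v : ℕ) : ℕ := v % 45

/-- The vertex of cell `(i, j)` at local point `s`. [cite: BlaserDorflerIkenmeyer2020, Lemma 28, proof (arXiv; = CCC 2021 Lemma 8.7)] -/
def enc (V i j s : ℕ) : ℕ := 45 * (V * i + j) + s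

/-- The grid position of a vertex: cell `(i, j)` is the box with corner `(8j, 8i)`.
[cite: BlaserDorflerIkenmeyer2020, Lemma 28, proof ("subgraph of an O(m) × O(m) grid") (arXiv; = CCC 2021 Lemma 8.7)] -/
def posN (V v : ℕ) : ℕ × ℕ := (8 * colOf V v + (off (locOf v)).1, 8 * rowOf V v + (off (locOf v)).2)

/-! ### The edge predicates -/

/-- One orientation of the equality edges: local equality edges inside a cell; the JOIN edge
`44–26` in the diagonal cells `(i, i)` (row wire `i` = column wire `i`); the column link
`(cell (i,j), 31) – (cell (i+1,j), 25)`; the row link `(cell (i,j), 38) – (cell (i,j+1), 32)`.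
[cite: BlaserDorflerIkenmeyer2020, Lemma 28, proof (arXiv; = CCC 2021 Lemma 8.7)] -/
def eqTest (V v w : ℕ) : Bool :=
  (v / 45 == w / 45 && decide ((locOf v, locOf w) ∈ localEq)) ||
    (v / 45 == w / 45 && rowOf V v == colOf V v && locOf v == 44 && locOf w == 26) ||
    (colOf V w == colOf V v && rowOf V w == rowOf V v + 1 && locOf v == 31 && locOf w == 25) ||
    (rowOf V w == rowOf V v && colOf V w == colOf V v + 1 && locOf v == 38 && locOf w == 32)

/-- One orientation of the inequality edges: local inequality edges inside a cell (`H_4'`) and the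
RELATION edge `44–26` in the cells `(i, j)`, `i ≠ j`, with `adj i j` (row wire `i ≠` column wire `j`).
[cite: BlaserDorflerIkenmeyer2020, Lemma 28, proof (arXiv; = CCC 2021 Lemma 8.7)] -/
def neTest (V : ℕ) (adj : ℕ → ℕ → Bool) (v w : ℕ) : Bool :=
  (v / 45 == w / 45 && decide ((locOf v, locOf w) ∈ localNe)) ||
    (v / 45 == w / 45 && !(rowOf V v == colOf V v) && adj (rowOf V v) (colOf V v) &&
      locOf v == 44 && locOf w == 26)

/-- The (symmetric) equality adjacency. [cite: BlaserDorflerIkenmeyer2020, Lemma 28, proof (arXiv; = CCC 2021 Lemma 8.7)] -/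
def eqB (V v w : ℕ) : Bool := eqTest V v w || eqTest V w v

/-- The (symmetric) inequality adjacency. [cite: BlaserDorflerIkenmeyer2020, Lemma 28, proof (arXiv; = CCC 2021 Lemma 8.7)] -/
def neB (V : ℕ) (adj : ℕ → ℕ → Bool) (v w : ℕ) : Bool := neTest V adj v w || neTest V adj w v

/-! ### Finite facts about the cell (kernel checks) -/

/-- The local offsets lie in the box `[0,8)²`. [cite: BlaserDorflerIkenmeyer2020, Lemma 28, proof (arXiv; = CCC 2021 Lemma 8.7)] -/
theorem off_lt (s : ℕ) (hs : s < 45) : (off s).1 < 8 ∧ (off s).2 < 8 := by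
  revert s; decide

/-- The local offsets are pairwise distinct. [cite: BlaserDorflerIkenmeyer2020, Lemma 28, proof (arXiv; = CCC 2021 Lemma 8.7)] -/
theorem off_injective : ∀ s < 45, ∀ s' < 45, off s = off s' → s = s' := by
  decide

/-- Every local edge joins two local points at unit grid distance. [cite: BlaserDorflerIkenmeyer2020, Lemma 28, proof ("G is a subgraph of a grid graph") (arXiv; = CCC 2021 Lemma 8.7)] -/
theorem local_grid : ∀ e ∈ localEq ++ localNe, e.1 < 45 ∧ e.2 < 45 ∧ GridAdjacent (off e.1) (off e.2) := by
  unfold GridAdjacent; decide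

/-- Every local point lies on a local edge (no isolated vertices, as Lemma 29's regularisation
requires). [cite: BlaserDorflerIkenmeyer2020, Lemma 26, proof ("every vertex of the grid graph has a degree between 1 and 4") (arXiv; = CCC 2021 Lemma 8.5)] -/
theorem local_covered : ∀ s < 45, ∃ e ∈ localEq ++ localNe, e.1 = s ∨ e.2 = s := by
  decide


/-! ### Index arithmetic -/

/-- Decoding an encoded vertex. [folklore] -/
private theorem locOf_enc {V i j s : ℕ} (hs : s < 45) : locOf (enc V i j s) = s := by
  unfold locOf enc; omega

/-- Decoding an encoded vertex. [folklore] -/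
private theorem div_enc {V i j s : ℕ} (hs : s < 45) : enc V i j s / 45 = V * i + j := by
  unfold enc; omega

/-- Decoding an encoded vertex. [folklore] -/
private theorem rowOf_enc {V i j s : ℕ} (hj : j < V) (hs : s < 45) : rowOf V (enc V i j s) = i := by
  unfold rowOf; rw [div_enc hs]
  rw [Nat.add_div_of_dvd_right ⟨i, rfl⟩, Nat.mul_div_cancel_left _ (by omega), Nat.div_eq_of_lt hj]; rfl

/-- Decoding an encoded vertex. [folklore] -/
private theorem colOf_enc {V i j s : ℕ} (hj : j < V) (hs : s < 45) : colOf V (enc V i j s) = j := by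
  unfold colOf; rw [div_enc hs, Nat.mul_add_mod_self_left, Nat.mod_eq_of_lt hj]

/-- Re-encoding a vertex from its coordinates. [folklore] -/
private theorem enc_rowOf_colOf_locOf (V v : ℕ) : enc V (rowOf V v) (colOf V v) (locOf v) = v := by
  unfold enc rowOf colOf locOf
  have h1 := Nat.div_add_mod (v / 45) V
  have h2 := Nat.div_add_mod v 45
  rw [h1]; exact h2

/-- Bounds of the coordinates. [folklore] -/
private theorem rowOf_lt {V v : ℕ} (hv : v < nV V) : rowOf V v < V := by
  unfold rowOf nV at *
  rcases Nat.eq_zero_or_pos V with rfl | hV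
  · simp at hv
  · exact Nat.div_lt_of_lt_mul (by rw [Nat.mul_comm] at hv; omega)

/-- Bounds of the coordinates. [folklore] -/
private theorem colOf_lt {V v : ℕ} (hv : v < nV V) : colOf V v < V := by
  unfold colOf nV at *
  rcases Nat.eq_zero_or_pos V with rfl | hV
  · simp at hv
  · exact Nat.mod_lt _ hV

/-- Bounds of the coordinates. [folklore] -/
private theorem locOf_lt (v : ℕ) : locOf v < 45 := Nat.mod_lt _ (by norm_num)

/-- Encoded vertices are in range. [folklore] -/
private theorem enc_lt {V i j s : ℕ} (hi : i < V) (hj : j < V) (hs : s < 45) : enc V i j s < nV V := by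
  unfold enc nV
  have : V * i + j < V * V := by nlinarith
  nlinarith

/-- Two vertices lie in the same cell iff their rows and columns agree. [folklore] -/
private theorem div_eq_iff {V v w : ℕ} :
    v / 45 = w / 45 ↔ rowOf V v = rowOf V w ∧ colOf V v = colOf V w := by
  unfold rowOf colOf
  constructor
  · intro h; rw [h]; exact ⟨rfl, rfl⟩
  · rintro ⟨h1, h2⟩
    rw [← Nat.div_add_mod (v / 45) V, ← Nat.div_add_mod (w / 45) V, h1, h2]

/-! ### The crossbar as a relational grid graph -/

/-- Grid adjacency is translation invariant. [folklore] -/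
private theorem gridAdjacent_add {p q : ℕ × ℕ} (h : GridAdjacent p q) (a b : ℕ) :
    GridAdjacent (a + p.1, b + p.2) (a + q.1, b + q.2) := by
  unfold GridAdjacent at *; simp only; omega

/-- Local edges are grid edges after translation to their cell. [cite: BlaserDorflerIkenmeyer2020, Lemma 28, proof ("G is a subgraph of a grid graph") (arXiv; = CCC 2021 Lemma 8.7)] -/
private theorem gridAdjacent_of_local {V v w : ℕ} (hbox : v / 45 = w / 45)
    (he : (locOf v, locOf w) ∈ localEq ++ localNe) : GridAdjacent (posN V v) (posN V w) := by
  obtain ⟨-, -, hg⟩ := local_grid _ he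
  obtain ⟨hr, hcl⟩ := (div_eq_iff (V := V)).1 hbox
  unfold posN
  rw [← hr, ← hcl]
  exact gridAdjacent_add hg _ _

/-- The join / relation edge `44–26` is a unit grid edge. [cite: BlaserDorflerIkenmeyer2020, Lemma 28, proof (arXiv; = CCC 2021 Lemma 8.7)] -/
private theorem gridAdjacent_rel {V v w : ℕ} (hbox : v / 45 = w / 45) (h44 : locOf v = 44)
    (h26 : locOf w = 26) : GridAdjacent (posN V v) (posN V w) := by
  obtain ⟨hr, hcl⟩ := (div_eq_iff (V := V)).1 hbox
  unfold posN
  rw [← hr, ← hcl, h44, h26]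
  exact gridAdjacent_add (by unfold GridAdjacent; decide) _ _

/-- A local equality edge in a common cell is an `eqTest` edge. [folklore] -/
private theorem eqTest_of_local {V v w : ℕ} (hbox : v / 45 = w / 45)
    (h : (locOf v, locOf w) ∈ localEq) : eqTest V v w = true := by
  unfold eqTest; simp [hbox, h]

/-- A local inequality edge in a common cell is a `neTest` edge. [folklore] -/
private theorem neTest_of_local {V : ℕ} {adj : ℕ → ℕ → Bool} {v w : ℕ} (hbox : v / 45 = w / 45)
    (h : (locOf v, locOf w) ∈ localNe) : neTest V adj v w = true := by
  unfold neTest; simp [hbox, h]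

/-- Every `eqTest` edge is a unit grid edge. [cite: BlaserDorflerIkenmeyer2020, Lemma 28, proof (arXiv; = CCC 2021 Lemma 8.7)] -/
private theorem gridAdjacent_of_eqTest {V v w : ℕ} (h : eqTest V v w = true) :
    GridAdjacent (posN V v) (posN V w) := by
  unfold eqTest at h
  simp only [Bool.or_eq_true, Bool.and_eq_true, beq_iff_eq, decide_eq_true_eq] at h
  rcases h with ((⟨hb, hm⟩ | ⟨⟨⟨hb, -⟩, h44⟩, h26⟩) | ⟨⟨⟨hc, hr⟩, h31⟩, h25⟩) | ⟨⟨⟨hr, hc⟩, h38⟩, h32⟩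
  · exact gridAdjacent_of_local hb (List.mem_append_left _ hm)
  · exact gridAdjacent_rel hb h44 h26
  · unfold posN GridAdjacent; rw [h31, h25, hc, hr]; simp [off, offTable]; omega
  · unfold posN GridAdjacent; rw [h38, h32, hc, hr]; simp [off, offTable]; omega

/-- Every `neTest` edge is a unit grid edge. [cite: BlaserDorflerIkenmeyer2020, Lemma 28, proof (arXiv; = CCC 2021 Lemma 8.7)] -/
private theorem gridAdjacent_of_neTest {V : ℕ} {adj : ℕ → ℕ → Bool} {v w : ℕ}
    (h : neTest V adj v w = true) : GridAdjacent (posN V v) (posN V w) := by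
  unfold neTest at h
  simp only [Bool.or_eq_true, Bool.and_eq_true, beq_iff_eq, decide_eq_true_eq] at h
  rcases h with ⟨hb, hm⟩ | ⟨⟨⟨⟨hb, -⟩, -⟩, h44⟩, h26⟩
  · exact gridAdjacent_of_local hb (List.mem_append_right _ hm)
  · exact gridAdjacent_rel hb h44 h26

/-- The positions are injective on the vertex range. [cite: BlaserDorflerIkenmeyer2020, Def. 24 (1) / Lemma 28 ("subgraph of a grid") (arXiv; = CCC 2021 Def. 8.3, Lemma 8.7)] -/
private theorem posN_injective {V v w : ℕ} (h : posN V v = posN V w) : v = w := by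
  unfold posN at h
  simp only [Prod.mk.injEq] at h
  obtain ⟨hx, hy⟩ := h
  have bv := off_lt (locOf v) (locOf_lt v)
  have bw := off_lt (locOf w) (locOf_lt w)
  have hc : colOf V v = colOf V w := by omega
  have hr : rowOf V v = rowOf V w := by omega
  have ho : off (locOf v) = off (locOf w) := Prod.ext (by omega) (by omega)
  have hl : locOf v = locOf w := off_injective _ (locOf_lt v) _ (locOf_lt w) ho
  rw [← enc_rowOf_colOf_locOf V v, ← enc_rowOf_colOf_locOf V w, hr, hc, hl]

/-- **The crossbar** of a graph on `V` vertices with adjacency `adj`: a subgraph of the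
`8V × 8V` grid with equality and inequality edges (FILE A's `RelGridGraph`), `45 V²` vertices —
cell `(i, j)` crosses row wire `i` with column wire `j` through a copy of `H_4'`, joins them when
`i = j`, and separates them by an inequality edge when `adj i j`. (Replaces the layout of Lemma 28:
same ingredients — a grid subgraph with relational edges and the crossing gadget `H_4'` — with no
sorting procedure; see the module docstring.)
[cite: BlaserDorflerIkenmeyer2020, Lemma 28 (arXiv; = CCC 2021 Lemma 8.7), proof] -/
def crossbar (V : ℕ) (adj : ℕ → ℕ → Bool) : RelGridGraph (nV V) where
  pos v := posN V v.val
  pos_injective := fun v w h => Fin.ext (posN_injective h)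
  eqAdj v w := eqB V v.val w.val
  neAdj v w := neB V adj v.val w.val
  eqAdj_comm v w := by unfold eqB; rw [Bool.or_comm]
  neAdj_comm v w := by unfold neB; rw [Bool.or_comm]
  eqAdj_grid v w h := by
    unfold eqB at h
    rcases Bool.or_eq_true_iff.1 h with h | h
    · exact gridAdjacent_of_eqTest h
    · exact gridAdjacent_comm.1 (gridAdjacent_of_eqTest h)
  neAdj_grid v w h := by
    unfold neB at h
    rcases Bool.or_eq_true_iff.1 h with h | h
    · exact gridAdjacent_of_neTest h
    · exact gridAdjacent_comm.1 (gridAdjacent_of_neTest h)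

/-- The crossbar fits in the `8V × 8V` grid. [cite: BlaserDorflerIkenmeyer2020, Lemma 28 ("subgraph of an O(m) × O(m) grid") (arXiv; = CCC 2021 Lemma 8.7)] -/
theorem pos_lt {V : ℕ} {adj : ℕ → ℕ → Bool} (v : Fin (nV V)) :
    ((crossbar V adj).pos v).1 < 8 * V ∧ ((crossbar V adj).pos v).2 < 8 * V := by
  have hc := colOf_lt v.2
  have hr := rowOf_lt v.2
  have ho := off_lt (locOf v.val) (locOf_lt _)
  simp only [crossbar, posN]
  constructor <;> nlinarith

/-- **No isolated vertices** (the hypothesis of Lemma 29's `8`-regularisation): every crossbar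
vertex lies on an equality or inequality edge. [cite: BlaserDorflerIkenmeyer2020, Lemma 26, proof ("every vertex of the grid graph has a degree between 1 and 4") (arXiv; = CCC 2021 Lemma 8.5)] -/
theorem exists_adj {V : ℕ} (adj : ℕ → ℕ → Bool) (v : Fin (nV V)) :
    ∃ w, (crossbar V adj).eqAdj v w = true ∨ (crossbar V adj).neAdj v w = true := by
  obtain ⟨e, he, hs⟩ := local_covered (locOf v.val) (locOf_lt _)
  obtain ⟨h1, h2, -⟩ := local_grid e he
  have hr := rowOf_lt v.2
  have hc := colOf_lt v.2
  -- the partner: the other end of `e`, in the same cell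
  set s' := if e.1 = locOf v.val then e.2 else e.1 with hs'
  have hs'lt : s' < 45 := by rw [hs']; split_ifs <;> assumption
  refine ⟨⟨enc V (rowOf V v.val) (colOf V v.val) s', enc_lt hr hc hs'lt⟩, ?_⟩
  have hbox : v.val / 45 = enc V (rowOf V v.val) (colOf V v.val) s' / 45 := by
    rw [div_enc hs'lt]; unfold rowOf colOf; exact (Nat.div_add_mod _ _).symm
  have hloc : locOf (enc V (rowOf V v.val) (colOf V v.val) s') = s' := locOf_enc hs'lt
  have hother : (e.1 = locOf v.val ∧ e.2 = s') ∨ (e.2 = locOf v.val ∧ e.1 = s') := by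
    by_cases h : e.1 = locOf v.val
    · exact Or.inl ⟨h, by rw [hs', if_pos h]⟩
    · exact Or.inr ⟨by rcases hs with hs | hs; exact absurd hs h; exact hs, by rw [hs', if_neg h]⟩
  simp only [crossbar, eqB, neB, Bool.or_eq_true]
  rcases List.mem_append.1 he with he | he
  · left
    rcases hother with ⟨h1, h2⟩ | ⟨h1, h2⟩
    · left; exact eqTest_of_local hbox (by rw [hloc, ← h1, ← h2]; exact he)
    · right; exact eqTest_of_local hbox.symm (by rw [hloc, ← h1, ← h2]; exact he)
  · right
    rcases hother with ⟨h1, h2⟩ | ⟨h1, h2⟩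
    · left; exact neTest_of_local hbox (by rw [hloc, ← h1, ← h2]; exact he)
    · right; exact neTest_of_local hbox.symm (by rw [hloc, ← h1, ← h2]; exact he)


/-! ### Correctness: relational 3-colourings of the crossbar ↔ proper 3-colourings of the graph -/

section Correctness

variable {V : ℕ} {adj : ℕ → ℕ → Bool}

/-- **Proper 3-colourings of the input graph** (vertices `0, …, V-1`, adjacency `adj`; loops are
ignored). [cite: BlaserDorflerIkenmeyer2020, Lemma 28 (arXiv; = CCC 2021 Lemma 8.7)] -/
def IsProperFor (V : ℕ) (adj : ℕ → ℕ → Bool) (col : ℕ → Fin 3) : Prop :=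
  ∀ i j, i < V → j < V → i ≠ j → adj i j = true → col i ≠ col j

/-- A colouring of `Fin n` extended to `ℕ`. [folklore] -/
private def cN {n : ℕ} (c : Fin n → Fin 3) (v : ℕ) : Fin 3 := if h : v < n then c ⟨v, h⟩ else 0

/-- Reading `cN` on the range. [folklore] -/
private theorem cN_of_lt {n : ℕ} (c : Fin n → Fin 3) {v : ℕ} (h : v < n) : cN c v = c ⟨v, h⟩ := by
  simp [cN, h]

/-- **The wires inside one cell**: if a colouring respects the local edges of a cell, the column
wire enters and leaves with one colour (`25 = 26 = a`, `a' = 27 = ⋯ = 31`, `a = a'` by `H_4'`), the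
row wire likewise (`32 = 33 = b'`, `b = 34 = ⋯ = 38`, `b' = b`), and the stub carries the row colour
(`32 = 39 = ⋯ = 44`). [cite: BlaserDorflerIkenmeyer2020, Lemma 28, proof ("In H_4' the vertices pairs labeled a, a' and b, b' each have the same color"; "connected by a path of equality edges") (arXiv; = CCC 2021 Lemma 8.7)] -/
theorem cell_wires (L : ℕ → Fin 3) (hEq : ∀ e ∈ localEq, L e.1 = L e.2)
    (hNe : ∀ e ∈ localNe, L e.1 ≠ L e.2) :
    L 31 = L 25 ∧ L 26 = L 25 ∧ L 38 = L 32 ∧ L 44 = L 32 := by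
  have hH : ProperRel crossingGadget.eqEdges crossingGadget.neEdges (fun t : Fin 25 => L t.val) :=
    ⟨fun e he => hEq (e.1.val, e.2.val) (List.mem_append_left _ (List.mem_map.2 ⟨e, he, rfl⟩)),
      fun e he => hNe (e.1.val, e.2.val) (List.mem_map.2 ⟨e, he, rfl⟩)⟩
  obtain ⟨h24', h20'⟩ := crossingGadget_forces _ hH
  have h24 : L 24 = L 0 := by simpa using h24'
  have h20 : L 20 = L 4 := by simpa using h20'
  have E : ∀ a b : ℕ, (a, b) ∈ localEq → L a = L b := fun a b h => hEq (a, b) h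
  have e1 := E 25 26 (by decide); have e2 := E 26 0 (by decide); have e3 := E 24 27 (by decide)
  have e4 := E 27 28 (by decide); have e5 := E 28 29 (by decide); have e6 := E 29 30 (by decide)
  have e7 := E 30 31 (by decide); have e8 := E 32 33 (by decide); have e9 := E 33 20 (by decide)
  have e10 := E 4 34 (by decide); have e11 := E 34 35 (by decide); have e12 := E 35 36 (by decide)
  have e13 := E 36 37 (by decide); have e14 := E 37 38 (by decide); have e15 := E 32 39 (by decide)
  have e16 := E 39 40 (by decide); have e17 := E 40 41 (by decide); have e18 := E 41 42 (by decide)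
  have e19 := E 42 43 (by decide); have e20 := E 43 44 (by decide)
  refine ⟨?_, ?_, ?_, ?_⟩
  · rw [← e7, ← e6, ← e5, ← e4, ← e3, h24, ← e2, ← e1]
  · rw [← e1]
  · rw [← e14, ← e13, ← e12, ← e11, ← e10, ← h20, ← e9, ← e8]
  · rw [← e20, ← e19, ← e18, ← e17, ← e16, ← e15]

variable (c : Fin (nV V) → Fin 3) (hc : (crossbar V adj).IsProperRel c)
include hc

/-- An `eqTest` edge is monochromatic. [cite: BlaserDorflerIkenmeyer2020, Lemma 28, proof (arXiv; = CCC 2021 Lemma 8.7)] -/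
private theorem eq_of_eqTest {v w : ℕ} (hv : v < nV V) (hw : w < nV V) (h : eqTest V v w = true) :
    cN c v = cN c w := by
  rw [cN_of_lt c hv, cN_of_lt c hw]
  exact hc.1 ⟨v, hv⟩ ⟨w, hw⟩ (by simp [crossbar, eqB, h])

/-- A `neTest` edge is bichromatic. [cite: BlaserDorflerIkenmeyer2020, Lemma 28, proof (arXiv; = CCC 2021 Lemma 8.7)] -/
private theorem ne_of_neTest {v w : ℕ} (hv : v < nV V) (hw : w < nV V) (h : neTest V adj v w = true) :
    cN c v ≠ cN c w := by
  rw [cN_of_lt c hv, cN_of_lt c hw]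
  exact hc.2 ⟨v, hv⟩ ⟨w, hw⟩ (by simp [crossbar, neB, h])

/-- The wires of cell `(i, j)`. [cite: BlaserDorflerIkenmeyer2020, Lemma 28, proof (arXiv; = CCC 2021 Lemma 8.7)] -/
private theorem cell_wires_at {i j : ℕ} (hi : i < V) (hj : j < V) :
    cN c (enc V i j 31) = cN c (enc V i j 25) ∧ cN c (enc V i j 26) = cN c (enc V i j 25) ∧
      cN c (enc V i j 38) = cN c (enc V i j 32) ∧ cN c (enc V i j 44) = cN c (enc V i j 32) := by
  refine cell_wires (fun s => cN c (enc V i j s)) (fun e he => ?_) (fun e he => ?_)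
  · obtain ⟨h1, h2, -⟩ := local_grid e (List.mem_append_left _ he)
    exact eq_of_eqTest c hc (enc_lt hi hj h1) (enc_lt hi hj h2)
      (eqTest_of_local (by rw [div_enc h1, div_enc h2]) (by rw [locOf_enc h1, locOf_enc h2]; exact he))
  · obtain ⟨h1, h2, -⟩ := local_grid e (List.mem_append_right _ he)
    exact ne_of_neTest c hc (enc_lt hi hj h1) (enc_lt hi hj h2)
      (neTest_of_local (by rw [div_enc h1, div_enc h2]) (by rw [locOf_enc h1, locOf_enc h2]; exact he))

/-- The column link: cell `(i+1, j)` receives the column colour of cell `(i, j)`.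
[cite: BlaserDorflerIkenmeyer2020, Lemma 28, proof (arXiv; = CCC 2021 Lemma 8.7)] -/
private theorem col_link {i j : ℕ} (hi : i + 1 < V) (hj : j < V) :
    cN c (enc V (i + 1) j 25) = cN c (enc V i j 31) := by
  refine (eq_of_eqTest c hc (enc_lt (by omega) hj (by norm_num)) (enc_lt hi hj (by norm_num)) ?_).symm
  unfold eqTest
  simp [rowOf_enc hj, colOf_enc hj, locOf_enc]

/-- The row link: cell `(i, j+1)` receives the row colour of cell `(i, j)`.
[cite: BlaserDorflerIkenmeyer2020, Lemma 28, proof (arXiv; = CCC 2021 Lemma 8.7)] -/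
private theorem row_link {i j : ℕ} (hi : i < V) (hj : j + 1 < V) :
    cN c (enc V i (j + 1) 32) = cN c (enc V i j 38) := by
  refine (eq_of_eqTest c hc (enc_lt hi (by omega) (by norm_num)) (enc_lt hi hj (by norm_num)) ?_).symm
  unfold eqTest
  simp [rowOf_enc hj, colOf_enc hj, rowOf_enc (Nat.lt_of_succ_lt hj), colOf_enc (Nat.lt_of_succ_lt hj),
    locOf_enc]

/-- **Row wire `i` carries one colour** along all cells `(i, j)`. [cite: BlaserDorflerIkenmeyer2020, Lemma 28, proof (arXiv; = CCC 2021 Lemma 8.7)] -/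
private theorem row_const {i : ℕ} (hi : i < V) : ∀ j, j < V → cN c (enc V i j 32) = cN c (enc V i 0 32)
  | 0, _ => rfl
  | j + 1, hj => by
    rw [row_link c hc hi hj, (cell_wires_at c hc hi (Nat.lt_of_succ_lt hj)).2.2.1,
      row_const hi j (Nat.lt_of_succ_lt hj)]

/-- **Column wire `j` carries one colour** along all cells `(i, j)`. [cite: BlaserDorflerIkenmeyer2020, Lemma 28, proof (arXiv; = CCC 2021 Lemma 8.7)] -/
private theorem col_const {j : ℕ} (hj : j < V) : ∀ i, i < V → cN c (enc V i j 25) = cN c (enc V 0 j 25)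
  | 0, _ => rfl
  | i + 1, hi => by
    rw [col_link c hc hi hj, (cell_wires_at c hc (Nat.lt_of_succ_lt hi) hj).1,
      col_const hj i (Nat.lt_of_succ_lt hi)]

/-- **The join**: row wire `i` and column wire `i` carry the same colour (cell `(i, i)`).
[cite: BlaserDorflerIkenmeyer2020, Lemma 28, proof ("vertices with the same labels will be connected by a path of equality edges, so they have the same color") (arXiv; = CCC 2021 Lemma 8.7)] -/
private theorem row_eq_col {i : ℕ} (hi : i < V) : cN c (enc V i 0 32) = cN c (enc V 0 i 25) := by
  have hw := cell_wires_at c hc hi hi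
  have hjoin : cN c (enc V i i 44) = cN c (enc V i i 26) := by
    refine eq_of_eqTest c hc (enc_lt hi hi (by norm_num)) (enc_lt hi hi (by norm_num)) ?_
    unfold eqTest
    simp [rowOf_enc hi, colOf_enc hi, locOf_enc, div_enc]
  rw [← row_const c hc hi i hi, ← col_const c hc hi i hi, ← hw.2.2.2, hjoin, hw.2.1]

omit hc in
/-- **From a relational 3-colouring of the crossbar to a proper 3-colouring of the graph**: colour
vertex `i` by its row wire; adjacent vertices get different colours (the relation edge of cell
`(i, j)`). [cite: BlaserDorflerIkenmeyer2020, Lemma 28, proof (arXiv; = CCC 2021 Lemma 8.7)] -/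
theorem isProperFor_of_isProperRel (hc : (crossbar V adj).IsProperRel c) :
    IsProperFor V adj fun i => cN c (enc V i 0 32) := by
  intro i j hi hj hij hadj
  have hw := cell_wires_at c hc hi hj
  have hrel : cN c (enc V i j 44) ≠ cN c (enc V i j 26) := by
    refine ne_of_neTest c hc (enc_lt hi hj (by norm_num)) (enc_lt hi hj (by norm_num)) ?_
    unfold neTest
    simp [rowOf_enc hj, colOf_enc hj, locOf_enc, hij, hadj, div_enc]
  rw [hw.2.2.2, hw.2.1, row_const c hc hi j hj, col_const c hc hj i hi, ← row_eq_col c hc hj] at hrel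
  exact hrel

end Correctness

/-! ### The converse: colouring the crossbar from a colouring of the graph -/

section Converse

variable {V : ℕ} {adj : ℕ → ℕ → Bool}

/-- **The colouring of one cell** with column colour `x` and row colour `y`: `H_4'` by FILE B's
`crossingColouring x y` (`a ↦ x`, `b ↦ y`), the column wire `x`, the row wire and the stub `y`.
[cite: BlaserDorflerIkenmeyer2020, Lemma 28, proof ("there is a proper 3-coloring for every choice of colors of a and b") (arXiv; = CCC 2021 Lemma 8.7)] -/
def cellColouring (x y : Fin 3) (s : ℕ) : Fin 3 :=
  if h : s < 25 then crossingColouring x y ⟨s, h⟩ else if s ≤ 31 then x else y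

/-- The cell colouring respects every local edge (kernel check over the nine port pairs).
[cite: BlaserDorflerIkenmeyer2020, Lemma 28, proof (arXiv; = CCC 2021 Lemma 8.7)] -/
theorem cellColouring_local (x y : Fin 3) :
    (∀ e ∈ localEq, cellColouring x y e.1 = cellColouring x y e.2) ∧
      ∀ e ∈ localNe, cellColouring x y e.1 ≠ cellColouring x y e.2 := by
  fin_cases x <;> fin_cases y <;> decide +kernel

/-- The wire colours of the cell colouring. [cite: BlaserDorflerIkenmeyer2020, Lemma 28, proof (arXiv; = CCC 2021 Lemma 8.7)] -/
theorem cellColouring_wires (x y : Fin 3) :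
    cellColouring x y 25 = x ∧ cellColouring x y 26 = x ∧ cellColouring x y 31 = x ∧
      cellColouring x y 32 = y ∧ cellColouring x y 38 = y ∧ cellColouring x y 44 = y := by
  simp [cellColouring]

/-- **The crossbar colouring induced by a vertex colouring `col`.** [cite: BlaserDorflerIkenmeyer2020, Lemma 28, proof (arXiv; = CCC 2021 Lemma 8.7)] -/
def crossbarColouring (V : ℕ) (col : ℕ → Fin 3) (v : Fin (nV V)) : Fin 3 :=
  cellColouring (col (colOf V v.val)) (col (rowOf V v.val)) (locOf v.val)

/-- `eqTest` edges are monochromatic under the induced colouring. [cite: BlaserDorflerIkenmeyer2020, Lemma 28, proof (arXiv; = CCC 2021 Lemma 8.7)] -/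
private theorem crossbarColouring_eqTest (col : ℕ → Fin 3) {v w : Fin (nV V)}
    (h : eqTest V v.val w.val = true) : crossbarColouring V col v = crossbarColouring V col w := by
  unfold crossbarColouring
  unfold eqTest at h
  simp only [Bool.or_eq_true, Bool.and_eq_true, beq_iff_eq, decide_eq_true_eq] at h
  rcases h with ((⟨hb, hm⟩ | ⟨⟨⟨hb, hrc⟩, h44⟩, h26⟩) | ⟨⟨⟨hc, hr⟩, h31⟩, h25⟩) | ⟨⟨⟨hr, hc⟩, h38⟩, h32⟩
  · obtain ⟨hr, hcl⟩ := (div_eq_iff (V := V)).1 hb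
    rw [← hr, ← hcl]
    exact (cellColouring_local _ _).1 _ hm
  · obtain ⟨hr, hcl⟩ := (div_eq_iff (V := V)).1 hb
    rw [← hr, ← hcl, h44, h26, (cellColouring_wires _ _).2.2.2.2.2, (cellColouring_wires _ _).2.1, hrc]
  · rw [h31, h25, hc, (cellColouring_wires _ _).2.2.1, (cellColouring_wires _ _).1]
  · rw [h38, h32, hr, (cellColouring_wires _ _).2.2.2.2.1, (cellColouring_wires _ _).2.2.2.1]

/-- `neTest` edges are bichromatic under the induced colouring of a PROPER vertex colouring.
[cite: BlaserDorflerIkenmeyer2020, Lemma 28, proof (arXiv; = CCC 2021 Lemma 8.7)] -/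
private theorem crossbarColouring_neTest {col : ℕ → Fin 3} (hcol : IsProperFor V adj col)
    {v w : Fin (nV V)} (h : neTest V adj v.val w.val = true) :
    crossbarColouring V col v ≠ crossbarColouring V col w := by
  unfold crossbarColouring
  unfold neTest at h
  simp only [Bool.or_eq_true, Bool.and_eq_true, beq_iff_eq, decide_eq_true_eq, Bool.not_eq_true',
    beq_eq_false_iff_ne, ne_eq] at h
  rcases h with ⟨hb, hm⟩ | ⟨⟨⟨⟨hb, hrc⟩, hadj⟩, h44⟩, h26⟩
  · obtain ⟨hr, hcl⟩ := (div_eq_iff (V := V)).1 hb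
    rw [← hr, ← hcl]
    exact (cellColouring_local _ _).2 _ hm
  · obtain ⟨hr, hcl⟩ := (div_eq_iff (V := V)).1 hb
    rw [← hr, ← hcl, h44, h26, (cellColouring_wires _ _).2.2.2.2.2, (cellColouring_wires _ _).2.1]
    exact hcol _ _ (rowOf_lt v.2) (colOf_lt v.2) hrc hadj

/-- **From a proper 3-colouring of the graph to a relational 3-colouring of the crossbar.**
[cite: BlaserDorflerIkenmeyer2020, Lemma 28, proof (arXiv; = CCC 2021 Lemma 8.7)] -/
theorem isProperRel_crossbarColouring {col : ℕ → Fin 3} (hcol : IsProperFor V adj col) :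
    (crossbar V adj).IsProperRel (crossbarColouring V col) := by
  refine ⟨fun v w h => ?_, fun v w h => ?_⟩
  · simp only [crossbar, eqB, Bool.or_eq_true] at h
    rcases h with h | h
    · exact crossbarColouring_eqTest col h
    · exact (crossbarColouring_eqTest col h).symm
  · simp only [crossbar, neB, Bool.or_eq_true] at h
    rcases h with h | h
    · exact crossbarColouring_neTest hcol h
    · exact (crossbarColouring_neTest hcol h).symm

/-- **The crossbar is relationally 3-colourable iff the graph is properly 3-colourable**
(Lemma 28's correctness for this layout: "the correctness of this reduction can easily be seen …
together with the properties of `H_4'`"). [cite: BlaserDorflerIkenmeyer2020, Lemma 28 (arXiv; = CCC 2021 Lemma 8.7), proof] -/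
theorem isRelColourable_crossbar_iff (V : ℕ) (adj : ℕ → ℕ → Bool) :
    (crossbar V adj).IsRelColourable ↔ ∃ col : ℕ → Fin 3, IsProperFor V adj col :=
  ⟨fun ⟨c, hc⟩ => ⟨_, isProperFor_of_isProperRel c hc⟩,
    fun ⟨_, hcol⟩ => ⟨_, isProperRel_crossbarColouring hcol⟩⟩

end Converse

end Crossbar

end BDI2020

end Literature.Computability.AlgebraicComplexity
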